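import Literature.MathematicalPhysics.QuantumFieldTheory.ConstructiveQFTWave0
import Literature.RepresentationTheory.CompactGroups.UnitaryTrick
import HarnessLib

/-!
# Wilson lattice gauge theory on a periodic lattice with marked translations (gauge-boot, L3(σ) part 1)

HONEST FRAMING (cell `pub-gaugeboot`, page 1 of every file): the venture produces certified bounds
on lattice expectations at stated coupling, gauge group, dimension and torus size; NOT a mass gap,
NOT a continuum limit, NOT a string tension; NOT Yang–Mills-summit-bearing (barriers
`FixedCouplingUltralocality`, `PerturbativeInvisibility`).

Task L3(σ) of the cell is the POSITIVE counterpart of the torus negatives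
(`DiagonalRPTorusNegative.lean` ff.): reflection positivity in the diagonal hyperplanes
`x_i = x_j` for the Wilson action on the periodic box WITH SIDES AT 45° of
Fröhlich–Israel–Lieb–Simon (J. Stat. Phys. 22 (1980) 297, §3, Model 3.1: "the usual finite-volume
cutoffs destroy this RP, but … one takes a periodic box with sides at 45°"), i.e. `ℤ^d` modulo the
lattice `{x : 2M_u ∣ x_i + x_j, 2M_v ∣ x_i - x_j, L ∣ x_k (k ∉ {i, j})}`. That box is not the cubic
torus `(ℤ/L)^d` of the tree's `GaugeConfig d L`, so this first module sets up the Wilson theory on a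
general PERIODIC LATTICE: a finite additive commutative group `A` of sites with `d` marked
translations `e : Fin d → A` (the images of the unit vectors). Everything is the verbatim analogue
of `Literature.MathematicalPhysics.QuantumFieldTheory.ConstructiveQFTWave0` §S11:

* `Config A d G = A × Fin d → G` — an element of `G` on every positively oriented link
  `(x, k) : x → x + e k`;
* `holonomy e U x k l = U(x,k) U(x + e_k, l) U(x + e_l, k)⁻¹ U(x, l)⁻¹`, `plaqObs ρ e p U = Re tr ρ(U_p)`
  for a plaquette `p = (x, ⟨(k, l), k < l⟩)`, `wilsonAction ρ e U = ∑_p (N - Re tr ρ(U_p))`;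
* `productHaar A d G` — product of normalised Haar measures over the links; `gibbs ρ e β` — the
  Wilson probability measure `Z⁻¹ e^{-β S} ∏ dU` (Mathlib `Measure.tilted`), a probability measure
  for continuous `ρ` (`isProbabilityMeasure_gibbs`), with the integration formula `integral_gibbs`.

The cubic torus is the instance `A = Fin d → ZMod L`, `e k = Pi.single k 1`; the tilted box is the
instance of `TiltedBox.lean`. The reflection-positivity theorem is proved for every periodic lattice
carrying a "tilted diagonal frame" in `TiltedRPGeometry/Plaquettes/Positivity.lean`.

References: K. Wilson, Phys. Rev. D 10 (1974) 2445; E. Seiler, LNP 159 (1982) Ch. 1–2;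
J. Fröhlich, R. Israel, E. H. Lieb, B. Simon, J. Stat. Phys. 22 (1980) 297, §3.
-/

noncomputable section

open MeasureTheory Complex
open Literature.MathematicalPhysics.QuantumFieldTheory (haarProbability)
open Literature.RepresentationTheory.CompactGroups

namespace Summit.QuantumFields.GaugeBoot

namespace TiltedRP

/-! ## Sites, links, plaquettes, configurations -/

/-- Ordered pairs of distinct directions `k < l` (the plane of a plaquette). -/
abbrev DirPair (d : ℕ) : Type := {p : Fin d × Fin d // p.1 < p.2}

/-- Positively oriented links of a periodic lattice with site group `A`: `(x, k)` is the link from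
`x` to `x + e k`. -/
abbrev Link (A : Type*) (d : ℕ) : Type _ := A × Fin d

/-- Plaquettes: `(x, ⟨(k, l), k < l⟩)` is the unit square at `x` spanned by `e k`, `e l`. -/
abbrev Plaq (A : Type*) (d : ℕ) : Type _ := A × DirPair d

/-- Gauge configurations: a group element on every positively oriented link. -/
abbrev Config (A : Type*) (d : ℕ) (G : Type*) : Type _ := Link A d → G

variable {A : Type*} [AddCommGroup A] {d N : ℕ} {G : Type*} [Group G]

/-- Plaquette holonomy `U_p = U(x,k) U(x + e_k, l) U(x + e_l, k)⁻¹ U(x, l)⁻¹` around the plaquette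
at `x` in the `(k, l)` plane of the periodic lattice with translations `e`. -/
def holonomy (e : Fin d → A) (U : Config A d G) (x : A) (k l : Fin d) : G :=
  U (x, k) * U (x + e k, l) * (U (x + e l, k))⁻¹ * (U (x, l))⁻¹

variable (ρ : G →* Matrix (Fin N) (Fin N) ℂ)

/-- The plaquette observable `Re tr ρ(U_p)`. -/
def plaqObs (e : Fin d → A) (p : Plaq A d) (U : Config A d G) : ℝ :=
  ((ρ (holonomy e U p.1 p.2.1.1 p.2.1.2)).trace).re

/-- The Wilson action `S(U) = ∑_p (N - Re tr ρ(U_p))` over all plaquettes of the periodic lattice. -/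
def wilsonAction [Fintype A] (e : Fin d → A) (U : Config A d G) : ℝ :=
  ∑ p : Plaq A d, ((N : ℝ) - plaqObs ρ e p U)

/-- Reversing the orientation of a plaquette inverts its holonomy. -/
theorem holonomy_swap_dirs (e : Fin d → A) (U : Config A d G) (x : A) (k l : Fin d) :
    holonomy e U x l k = (holonomy e U x k l)⁻¹ := by
  simp only [holonomy, mul_inv_rev, inv_inv, mul_assoc]

/-- The holonomy is determined by the four links of the plaquette. -/
theorem holonomy_congr (e : Fin d → A) {U V : Config A d G} (x : A) (k l : Fin d)
    (h1 : U (x, k) = V (x, k)) (h2 : U (x + e k, l) = V (x + e k, l))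
    (h3 : U (x + e l, k) = V (x + e l, k)) (h4 : U (x, l) = V (x, l)) :
    holonomy e U x k l = holonomy e V x k l := by
  simp only [holonomy, h1, h2, h3, h4]

section Topology

variable [TopologicalSpace G] [IsTopologicalGroup G]

/-- The holonomy is a continuous function of the configuration. -/
theorem continuous_holonomy (e : Fin d → A) (x : A) (k l : Fin d) :
    Continuous fun U : Config A d G => holonomy e U x k l := by
  unfold holonomy
  fun_prop

/-- For a continuous representation the plaquette observable is continuous. -/
theorem continuous_plaqObs (hρ : Continuous ρ) (e : Fin d → A) (p : Plaq A d) :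
    Continuous (plaqObs (G := G) ρ e p) := by
  unfold plaqObs
  exact Complex.continuous_re.comp (Continuous.matrix_trace (hρ.comp (continuous_holonomy e _ _ _)))

/-- The Wilson action of a continuous representation is continuous. -/
theorem continuous_wilsonAction [Fintype A] (hρ : Continuous ρ) (e : Fin d → A) :
    Continuous (wilsonAction (G := G) ρ e) := by
  unfold wilsonAction
  exact continuous_finsetSum _ fun p _ => continuous_const.sub (continuous_plaqObs ρ hρ e p)

variable [CompactSpace G]

/-- `|Re tr ρ(U_p)| ≤ N` (compact group, continuous representation). -/
theorem abs_plaqObs_le (hρ : Continuous ρ) (e : Fin d → A) (p : Plaq A d) (U : Config A d G) :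
    |plaqObs ρ e p U| ≤ N := by
  simpa [plaqObs] using CompactGroup.abs_re_trace_le_card ρ hρ (holonomy e U p.1 p.2.1.1 p.2.1.2)

/-- A sum of plaquette observables over a finite set `S` is bounded by `N #S`. -/
theorem abs_sum_plaqObs_le (hρ : Continuous ρ) (e : Fin d → A) (S : Finset (Plaq A d))
    (U : Config A d G) : |∑ p ∈ S, plaqObs ρ e p U| ≤ N * S.card := by
  calc |∑ p ∈ S, plaqObs ρ e p U| ≤ ∑ p ∈ S, |plaqObs ρ e p U| := Finset.abs_sum_le_sum_abs _ _
    _ ≤ ∑ _p ∈ S, (N : ℝ) := Finset.sum_le_sum fun p _ => abs_plaqObs_le ρ hρ e p U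
    _ = N * S.card := by rw [Finset.sum_const, nsmul_eq_mul, mul_comm]

omit [TopologicalSpace G] [IsTopologicalGroup G] [CompactSpace G] in
/-- The Wilson action as `N · #plaquettes - ∑_p Re tr ρ(U_p)`. -/
theorem wilsonAction_eq [Fintype A] (e : Fin d → A) (U : Config A d G) :
    wilsonAction ρ e U = N * Fintype.card (Plaq A d) - ∑ p : Plaq A d, plaqObs ρ e p U := by
  rw [wilsonAction, Finset.sum_sub_distrib, Finset.sum_const, nsmul_eq_mul, mul_comm,
    Finset.card_univ]

end Topology

/-! ## The product Haar measure and the Wilson (Gibbs) probability measure -/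

section Measure

variable [TopologicalSpace G] [IsTopologicalGroup G] [CompactSpace G] [MeasurableSpace G]
  [BorelSpace G]

variable (A d G) in
/-- The product of the normalised Haar measures over the links of the periodic lattice. -/
def productHaar [Fintype A] : Measure (Config A d G) :=
  Measure.pi fun _ : Link A d => haarProbability G

omit [AddCommGroup A] in
/-- The product Haar measure is a probability measure. -/
theorem isProbabilityMeasure_productHaar [Fintype A] :
    IsProbabilityMeasure (productHaar A d G) := by
  haveI : IsProbabilityMeasure (haarProbability G) :=
    CompactGroup.isProbabilityMeasure_haarMeasure_top
  unfold productHaar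
  infer_instance

/-- The Wilson probability measure `Z⁻¹ e^{-β S(U)} ∏_links dU` of the periodic lattice
(Mathlib `Measure.tilted`; a probability measure for continuous `ρ`, `isProbabilityMeasure_gibbs`). -/
def gibbs [Fintype A] (e : Fin d → A) (β : ℝ) : Measure (Config A d G) :=
  (productHaar A d G).tilted fun U => -β * wilsonAction ρ e U

variable [Fintype A] [SecondCountableTopology G]

omit [CompactSpace G] [MeasurableSpace G] [BorelSpace G] [SecondCountableTopology G] in
/-- The Boltzmann weight `e^{-β S}` of a continuous representation is continuous. -/
theorem continuous_boltzmann (hρ : Continuous ρ) (e : Fin d → A) (β : ℝ) :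
    Continuous fun U : Config A d G => Real.exp (-β * wilsonAction ρ e U) :=
  Real.continuous_exp.comp (continuous_const.mul (continuous_wilsonAction ρ hρ e))

omit [MeasurableSpace G] [BorelSpace G] [SecondCountableTopology G] in
/-- Two-sided bounds on the Boltzmann weight: `e^{-|β| 2N#P} ≤ e^{-β S(U)} ≤ e^{|β| 2N#P}`. -/
theorem boltzmann_bounds (hρ : Continuous ρ) (e : Fin d → A) (β : ℝ) (U : Config A d G) :
    Real.exp (-(|β| * (2 * N * Fintype.card (Plaq A d)))) ≤ Real.exp (-β * wilsonAction ρ e U) ∧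
      Real.exp (-β * wilsonAction ρ e U) ≤ Real.exp (|β| * (2 * N * Fintype.card (Plaq A d))) := by
  have hS : |wilsonAction ρ e U| ≤ 2 * N * Fintype.card (Plaq A d) := by
    rw [wilsonAction_eq]
    have h1 := abs_sum_plaqObs_le ρ hρ e Finset.univ U
    rw [Finset.card_univ] at h1
    have h2 : |(N : ℝ) * Fintype.card (Plaq A d)| = N * Fintype.card (Plaq A d) :=
      abs_of_nonneg (by positivity)
    calc |(N : ℝ) * Fintype.card (Plaq A d) - ∑ p : Plaq A d, plaqObs ρ e p U|
        ≤ |(N : ℝ) * Fintype.card (Plaq A d)| + |∑ p : Plaq A d, plaqObs ρ e p U| := abs_sub _ _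
      _ ≤ N * Fintype.card (Plaq A d) + N * Fintype.card (Plaq A d) := by rw [h2]; linarith
      _ = 2 * N * Fintype.card (Plaq A d) := by ring
  have h : |-β * wilsonAction ρ e U| ≤ |β| * (2 * N * Fintype.card (Plaq A d)) := by
    rw [abs_mul, abs_neg]
    exact mul_le_mul_of_nonneg_left hS (abs_nonneg _)
  rw [abs_le] at h
  exact ⟨Real.exp_le_exp.2 h.1, Real.exp_le_exp.2 h.2⟩

/-- The Boltzmann weight is integrable for the product Haar measure. -/
theorem integrable_boltzmann (hρ : Continuous ρ) (e : Fin d → A) (β : ℝ) :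
    Integrable (fun U : Config A d G => Real.exp (-β * wilsonAction ρ e U)) (productHaar A d G) := by
  haveI := isProbabilityMeasure_productHaar (A := A) (d := d) (G := G)
  refine Integrable.of_bound (continuous_boltzmann ρ hρ e β).aestronglyMeasurable
    (Real.exp (|β| * (2 * N * Fintype.card (Plaq A d)))) (ae_of_all _ fun U => ?_)
  rw [Real.norm_eq_abs, abs_of_pos (Real.exp_pos _)]
  exact (boltzmann_bounds ρ hρ e β U).2

/-- **The normaliser is positive**: `0 < Z = ∫ e^{-β S} ∏ dU`. -/
theorem normaliser_pos (hρ : Continuous ρ) (e : Fin d → A) (β : ℝ) :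
    0 < ∫ U, Real.exp (-β * wilsonAction ρ e U) ∂(productHaar A d G) := by
  haveI := isProbabilityMeasure_productHaar (A := A) (d := d) (G := G)
  set c := Real.exp (-(|β| * (2 * N * Fintype.card (Plaq A d)))) with hc
  have hcpos : 0 < c := Real.exp_pos _
  calc (0 : ℝ) < c := hcpos
    _ = ∫ _U, c ∂(productHaar A d G) := by simp
    _ ≤ ∫ U, Real.exp (-β * wilsonAction ρ e U) ∂(productHaar A d G) :=
        integral_mono (integrable_const c) (integrable_boltzmann ρ hρ e β)
          fun U => (boltzmann_bounds ρ hρ e β U).1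

/-- **The Wilson measure of a periodic lattice is a probability measure** (continuous `ρ`). -/
theorem isProbabilityMeasure_gibbs (hρ : Continuous ρ) (e : Fin d → A) (β : ℝ) :
    IsProbabilityMeasure (gibbs (A := A) (G := G) ρ e β) := by
  haveI := isProbabilityMeasure_productHaar (A := A) (d := d) (G := G)
  exact isProbabilityMeasure_tilted (integrable_boltzmann ρ hρ e β)

omit [SecondCountableTopology G] in
/-- **Integration against the Wilson measure**:
`∫ F dμ_β = ∫ (e^{-β S(U)} / Z) • F(U) ∏ dU`. -/
theorem integral_gibbs {V : Type*} [NormedAddCommGroup V] [NormedSpace ℝ V] (e : Fin d → A)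
    (β : ℝ) (F : Config A d G → V) :
    ∫ U, F U ∂(gibbs ρ e β) = ∫ U, (Real.exp (-β * wilsonAction ρ e U) /
      ∫ U, Real.exp (-β * wilsonAction ρ e U) ∂(productHaar A d G)) • F U ∂(productHaar A d G) := by
  unfold gibbs
  rw [integral_tilted]

end Measure

end TiltedRP

end Summit.QuantumFields.GaugeBoot
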